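import Summits.Ventures.PercRepro.Night2T3Decay

/-!
# PercRepro — ABSORPTION: every coloop of `S` that is not a coloop of `G` is destroyed by some point of `G ∖ S`
(night-2 gen 3, NIGHT-2-profile.md §3c — the weighted-rise constraint of the profile LP)

For a rank-`q` set `G`, `S ∈ R_q(G)` and a coloop `k` of `M|S` which is not a coloop of `M|G`:
* `exists_notMem_closure_erase_of_not_coloop`: some `x ∈ G ∖ S` has `x ∉ cl(S ∖ k)` — otherwise `G ⊆ cl(S ∖ k) ∪ {k}`
  and `k` would be a coloop of `G`;
* `exists_notMem_coloopsOf_insert`: hence `k ∉ coloopsOf (S ∪ x)` for that `x` — the move `S ↦ S ∪ x` ABSORBS `k`;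
* **`card_coloops_le_sum_mTr_sub`**: summing over the outside points, `#(coloopsOf S ∖ coloopsOf G) ≤ Σ_{x ∈ G ∖ S} (m(S) − m(S ∪ x))`
  — the total cyclic-rank gain over all up-moves of `S` is at least the number of its absorbable coloops.

Imports `Night2T3Decay` (p377446) only.
-/
namespace PercRepro.Star

open Finset ThmH SixFour GenQ

variable {α : Type*} [DecidableEq α] {M : Matroid α} [M.Finite]

/-- A coloop `k` of `M|S` (`S` spanning in `G`) that is not a coloop of `M|G` has an outside point
`x ∈ G ∖ S` with `x ∉ cl(S ∖ k)`. -/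
theorem exists_notMem_closure_erase_of_not_coloop {G S : Finset α} {q : ℕ} (hG : G ⊆ gr M)
    (hS : S ∈ Rq M G q) {k : α} (hk : k ∈ coloopsOf M S)
    (hkG : k ∉ coloopsOf M G) : ∃ x ∈ G, x ∉ S ∧ x ∉ M.closure ((S.erase k : Finset α) : Set α) := by
  by_contra hall
  have hall' : ∀ x ∈ G, x ∉ S → x ∈ M.closure ((S.erase k : Finset α) : Set α) := by
    intro x hxG hxS
    by_contra hx
    exact hall ⟨x, hxG, hxS, hx⟩
  have hS' := mem_Rq.1 hS
  have hkS : k ∈ S := (mem_coloopsOf.1 hk).1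
  have hkG' : k ∈ G := hS'.1 hkS
  apply hkG
  rw [mem_coloopsOf]
  refine ⟨hkG', fun hcl => ?_⟩
  -- `G ∖ k ⊆ cl(S ∖ k)`, so `k ∈ cl(G ∖ k) ⊆ cl(S ∖ k)`, contradicting that `k` is a coloop of `S`
  apply (mem_coloopsOf.1 hk).2
  have hsub : ((G.erase k : Finset α) : Set α) ⊆ M.closure ((S.erase k : Finset α) : Set α) := by
    intro y hy
    have hy' := Finset.mem_coe.1 hy
    rw [Finset.mem_erase] at hy'
    by_cases hyS : y ∈ S
    · have hyE : y ∈ M.E := by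
        rw [← coe_gr M]
        exact Finset.mem_coe.2 (hG hy'.2)
      exact M.mem_closure_of_mem' (Finset.mem_coe.2 (Finset.mem_erase.2 ⟨hy'.1, hyS⟩)) hyE
    · exact hall' y hy'.2 hyS
  have h2 := M.closure_subset_closure_of_subset_closure hsub
  exact h2 hcl

/-- The absorbing point: `k ∉ coloopsOf (S ∪ x)`. -/
theorem exists_notMem_coloopsOf_insert {G S : Finset α} {q : ℕ} (hG : G ⊆ gr M)
    (hrG : M.eRk (G : Set α) = (q : ℕ∞)) (hS : S ∈ Rq M G q) {k : α} (hk : k ∈ coloopsOf M S)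
    (hkG : k ∉ coloopsOf M G) : ∃ x ∈ G, x ∉ S ∧ k ∉ coloopsOf M (insert x S) := by
  obtain ⟨x, hxG, hxS, hx⟩ := exists_notMem_closure_erase_of_not_coloop hG hS hk hkG
  refine ⟨x, hxG, hxS, fun hk' => hx ?_⟩
  have hS' := mem_Rq.1 hS
  have hr : M.eRk ((insert x S : Finset α) : Set α) = (q : ℕ∞) := by
    apply le_antisymm
    · rw [← hrG]
      exact M.eRk_mono (Finset.coe_subset.2 (Finset.insert_subset hxG hS'.1))
    · rw [← hS'.2]
      exact M.eRk_mono (Finset.coe_subset.2 (Finset.subset_insert x S))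
  have hxcl : x ∈ M.closure (S : Set α) := by
    apply mem_closure_of_eRk_insert_le' (hG hxG)
    rw [hr, hS'.2]
  exact mem_closure_erase_of_mem_coloopsOf_insert (hS'.1.trans hG) (hG hxG) hxS hxcl hk hk'

/-- **Absorption count**: `#(coloopsOf S ∖ coloopsOf G) ≤ Σ_{x ∈ G ∖ S} (m(S) − m(S ∪ x))` for `S ∈ R_q(G)`. -/
theorem card_coloops_le_sum_mTr_sub {G S : Finset α} {q : ℕ} (hG : G ⊆ gr M)
    (hrG : M.eRk (G : Set α) = (q : ℕ∞)) (hS : S ∈ Rq M G q) :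
    ((coloopsOf M S \ coloopsOf M G).card : ℤ) ≤
      ∑ x ∈ G \ S, ((mTr M S : ℤ) - (mTr M (insert x S) : ℤ)) := by
  have hS' := mem_Rq.1 hS
  -- `m(S) − m(S ∪ x) = #(coloopsOf S ∖ coloopsOf (S ∪ x))` since `coloopsOf (S ∪ x) ⊆ coloopsOf S`
  have hterm : ∀ x ∈ G \ S, ((mTr M S : ℤ) - (mTr M (insert x S) : ℤ)) =
      ((coloopsOf M S \ coloopsOf M (insert x S)).card : ℤ) := by
    intro x hx
    have hx' := Finset.mem_sdiff.1 hx
    have hr : M.eRk ((insert x S : Finset α) : Set α) = (q : ℕ∞) := by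
      apply le_antisymm
      · rw [← hrG]
        exact M.eRk_mono (Finset.coe_subset.2 (Finset.insert_subset hx'.1 hS'.1))
      · rw [← hS'.2]
        exact M.eRk_mono (Finset.coe_subset.2 (Finset.subset_insert x S))
    have hxcl : x ∈ M.closure (S : Set α) := by
      apply mem_closure_of_eRk_insert_le' (hG hx'.1)
      rw [hr, hS'.2]
    have hsub := coloopsOf_insert_subset (M := M) hx'.2 hxcl
    unfold mTr
    rw [Finset.card_sdiff_of_subset hsub]
    push_cast [Finset.card_le_card hsub]
    ring
  rw [Finset.sum_congr rfl hterm]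
  -- double count: Σ_x #(K ∖ K(S ∪ x)) = Σ_{k ∈ K} #{x : k ∉ K(S ∪ x)} ≥ #{k ∈ K ∖ K(G)}
  have hdc : ∑ x ∈ G \ S, ((coloopsOf M S \ coloopsOf M (insert x S)).card : ℤ) =
      ∑ k ∈ coloopsOf M S, (((G \ S).filter (fun x => k ∉ coloopsOf M (insert x S))).card : ℤ) := by
    have e1 : ∀ x ∈ G \ S, ((coloopsOf M S \ coloopsOf M (insert x S)).card : ℤ) =
        ∑ k ∈ coloopsOf M S, (if k ∉ coloopsOf M (insert x S) then (1 : ℤ) else 0) := by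
      intro x _
      rw [Finset.sum_boole, Finset.sdiff_eq_filter]
    have e2 : ∀ k ∈ coloopsOf M S, (((G \ S).filter (fun x => k ∉ coloopsOf M (insert x S))).card : ℤ) =
        ∑ x ∈ G \ S, (if k ∉ coloopsOf M (insert x S) then (1 : ℤ) else 0) := by
      intro k _
      rw [Finset.sum_boole]
    rw [Finset.sum_congr rfl e1, Finset.sum_congr rfl e2, Finset.sum_comm]
  rw [hdc]
  -- every `k ∈ K ∖ K(G)` contributes at least `1`
  have hge : ∀ k ∈ coloopsOf M S, (if k ∉ coloopsOf M G then (1 : ℤ) else 0) ≤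
      (((G \ S).filter (fun x => k ∉ coloopsOf M (insert x S))).card : ℤ) := by
    intro k hk
    by_cases hkG : k ∈ coloopsOf M G
    · rw [if_neg (not_not.2 hkG)]
      exact_mod_cast Nat.zero_le _
    · rw [if_pos hkG]
      obtain ⟨x, hxG, hxS, hx⟩ := exists_notMem_coloopsOf_insert hG hrG hS hk hkG
      have hmem : x ∈ (G \ S).filter (fun x => k ∉ coloopsOf M (insert x S)) :=
        Finset.mem_filter.2 ⟨Finset.mem_sdiff.2 ⟨hxG, hxS⟩, hx⟩
      have h1 : 1 ≤ ((G \ S).filter (fun x => k ∉ coloopsOf M (insert x S))).card :=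
        Finset.card_pos.2 ⟨x, hmem⟩
      exact_mod_cast h1
  have hcard : ((coloopsOf M S \ coloopsOf M G).card : ℤ) =
      ∑ k ∈ coloopsOf M S, (if k ∉ coloopsOf M G then (1 : ℤ) else 0) := by
    rw [Finset.sum_boole, Finset.sdiff_eq_filter]
  rw [hcard]
  exact Finset.sum_le_sum hge

end PercRepro.Star
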